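import Mathlib
import HarnessLib
import Literature.Analysis.FluidPDE.StatisticalSolutionEnergyEq
import Literature.Analysis.FluidPDE.StokesTorus
import Literature.Analysis.FunctionSpaces.HaarTorusBoundedTrigApprox

/-!
# Tools for `TameRoughRigidity.GPOrientationBridge` (stmt-AnomalousDissipation-18404):
# the axis swap `x₁ ↔ x₂` on fields over `T³`

The support item `GPOrientationBridge` of route `TameRoughRigidity` identifies
`ForcedSmallScales.CyclicForceCoercive` (no stationary statistical solution of the Euler equations
forced by `f₁ = sin(2πx₁)e₀ + sin(2πx₂)e₁ + sin(2πx₀)e₂`) with `GPEulerCoercive` (the same for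
`f_GP = sin(2πx₂)e₀ + sin(2πx₀)e₁ + sin(2πx₁)e₂`). The bridge is the coordinate swap
`σ = swap (1 : Fin 3) 2`, an involutive lattice isometry of `T³`: with `P x := x ∘ σ` on `T³`
(written inline as `fun i => x (σ i)`) and the linear isometry
`A := LinearIsometryEquiv.piLpCongrLeft 2 ℝ ℝ σ` of `ℝ³` (`(A w) i = w (σ i)`, `A ∘ A = id`), the
conjugation `w ↦ A ∘ w ∘ P` carries `f_GP` to `f₁` (`conj_gpForce`) and is a symmetry of the
forced Euler / Navier–Stokes system.

This file is the torus-level toolkit (pure proof file, no definitions; the conjugated fields are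
written inline, cf. the accepted `ImpulseGridBoundedEnergyGridStubAxisZeroOfAxisTwo.lean` for the
swap `(0 2)` on classical fields):
* change of variables and zero mean under `P` (`P` is the inverse of the measurable equivalence
  `MeasurableEquiv.piCongrLeft _ σ`, which preserves `volume`);
* calculus: `lift (w ∘ P) = lift w ∘ A` and `liftAt (A ∘ w ∘ P) x = A ∘ liftAt w (P x) ∘ A` hold by
  `rfl`, whence smoothness, `∂ᵢ (A ∘ w ∘ P) = A ∘ ∂_{σ i} w ∘ P`, `div`, `Δ` (smooth fields,
  `Torus.laplacian_eq_sum_partialDeriv_partialDeriv`) and the **unconditional** chain rule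
  `D(A ∘ w ∘ P)(x) = A ∘ Dw(Px) ∘ A` (`LinearIsometryEquiv.comp_fderiv`,
  `ContinuousLinearEquiv.comp_right_fderiv`), so that the inertial integrand
  `⟪D(AwP)(x)[Aa], Aa⟫ = ⟪Dw(Px)[a], a⟫` needs no differentiability;
* Fourier side: `𝓕(A ∘ v ∘ P)(k) = Aℂ (𝓕v)(k ∘ σ)` for every field (junk-free identity of Bochner
  integrals), hence the spectral enstrophy `Torus.eGradNormSq` is invariant (reindex the Fourier
  sum by `k ↦ k ∘ σ`);
* the two forces: `A ∘ f_GP ∘ P = f₁`, with `f₁` written with `Torus.frameField` exactly as in the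
  route decl and `f_GP` with `Torus.stokesMode` exactly as in `GPEulerCoercive`.

The operator on `H`, the push-forward of stationary statistical solutions and the route decl are
in `TameRoughRigidityGPOrientationBridge.lean`.

References: C. Foias, O. Manley, R. Rosa, R. Temam, *Navier–Stokes Equations and Turbulence*
(CUP 2001), Ch. IV §1.2 (the objects); the symmetry itself is folklore (Euler covariance under
lattice isometries of `T³`).
-/

-- `Summit.<Summit>.<Problem>` is the tree's mandated summit-side namespace (CONVENTIONS §2); for
-- this single-conjunct summit the two coincide, so the duplicate is deliberate.
set_option linter.dupNamespace false

noncomputable section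

open MeasureTheory Filter Topology Set UnitAddTorus
open scoped InnerProductSpace ENNReal
open Literature.Analysis.FunctionSpaces Literature.Analysis.FunctionSpaces.Torus
open Literature.Analysis.FluidPDE Literature.Analysis.FluidPDE.Torus
open LinearIsometryEquiv (piLpCongrLeft)
open Equiv (swap)

namespace Summit.AnomalousDissipation.AnomalousDissipation.Theorems.TameRoughRigidity

namespace OrientationBridge

/-! ## The swap on `ℝ³` and on `T³` -/

/-- `A` is an involution. [folklore] -/
theorem a_a (v : EuclideanSpace ℝ (Fin 3)) :
    piLpCongrLeft 2 ℝ ℝ (swap 1 2) (piLpCongrLeft 2 ℝ ℝ (swap (1 : Fin 3) 2) v) = v := by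
  ext i
  simp

/-- `A eᵢ = e_{σ i}` on the standard basis (any length). [folklore] -/
theorem a_single (i : Fin 3) (c : ℝ) :
    piLpCongrLeft 2 ℝ ℝ (swap 1 2) (EuclideanSpace.single i c) =
      EuclideanSpace.single (swap 1 2 i) c := by
  simp

/-- `⟪A a, b⟫ = ⟪a, A b⟫` (`A` is a self-inverse isometry). [folklore] -/
theorem inner_a_left (a b : EuclideanSpace ℝ (Fin 3)) :
    ⟪piLpCongrLeft 2 ℝ ℝ (swap (1 : Fin 3) 2) a, b⟫_ℝ =
      ⟪a, piLpCongrLeft 2 ℝ ℝ (swap (1 : Fin 3) 2) b⟫_ℝ := by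
  rw [← LinearIsometryEquiv.inner_map_map (piLpCongrLeft 2 ℝ ℝ (swap (1 : Fin 3) 2)) a
    (piLpCongrLeft 2 ℝ ℝ (swap (1 : Fin 3) 2) b), a_a]

/-- `P` preserves the Haar probability measure of `T³`. [folklore] -/
theorem measurePreserving_swap :
    MeasurePreserving (fun x : UnitAddTorus (Fin 3) => fun i => x (swap 1 2 i)) volume volume :=
  (MeasureTheory.volume_measurePreserving_piCongrLeft (fun _ : Fin 3 => UnitAddCircle)
    (swap (1 : Fin 3) 2)).symm _

/-- **Change of variables** `∫ g (P x) dx = ∫ g`. [folklore] -/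
theorem integral_comp_swap {F : Type*} [NormedAddCommGroup F] [NormedSpace ℝ F]
    (g : UnitAddTorus (Fin 3) → F) :
    ∫ x : UnitAddTorus (Fin 3), g (fun i => x (swap 1 2 i)) = ∫ x, g x :=
  ((MeasureTheory.volume_measurePreserving_piCongrLeft (fun _ : Fin 3 => UnitAddCircle)
    (swap (1 : Fin 3) 2)).symm _).integral_comp' g

/-- a.e. equalities are transported by `P`. [folklore] -/
theorem comp_swap_ae_eq {F : Type*} {f g : UnitAddTorus (Fin 3) → F} (h : f =ᵐ[volume] g) :
    (fun x : UnitAddTorus (Fin 3) => f (fun i => x (swap 1 2 i))) =ᵐ[volume]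
      fun x => g (fun i => x (swap 1 2 i)) :=
  measurePreserving_swap.quasiMeasurePreserving.ae_eq_comp h

/-- The conjugation `w ↦ A ∘ w ∘ P` preserves zero mean. [folklore] -/
theorem hasZeroMean_conj {w : UnitAddTorus (Fin 3) → EuclideanSpace ℝ (Fin 3)} (hw : HasZeroMean w) :
    HasZeroMean (fun x : UnitAddTorus (Fin 3) =>
      piLpCongrLeft 2 ℝ ℝ (swap 1 2) (w (fun i => x (swap 1 2 i)))) := by
  unfold HasZeroMean at hw ⊢
  change ∫ x : UnitAddTorus (Fin 3), (piLpCongrLeft 2 ℝ ℝ (swap (1 : Fin 3) 2)).toContinuousLinearEquiv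
    (w (fun i => x (swap 1 2 i))) = 0
  rw [ContinuousLinearEquiv.integral_comp_comm, integral_comp_swap (fun y => w y), hw, map_zero]

/-! ## Calculus of conjugated fields -/

/-- `lift (w ∘ P) = lift w ∘ A` (definitionally). [folklore] -/
theorem lift_comp_swap {F : Type*} (w : UnitAddTorus (Fin 3) → F) :
    lift (fun x : UnitAddTorus (Fin 3) => w (fun i => x (swap 1 2 i))) =
      lift w ∘ piLpCongrLeft 2 ℝ ℝ (swap (1 : Fin 3) 2) :=
  rfl

/-- `Cⁿ` functions stay `Cⁿ` after precomposition with `P` (`n = ∞` included). [folklore] -/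
theorem isContDiff_comp_swap {F : Type*} [NormedAddCommGroup F] [NormedSpace ℝ F]
    {n : WithTop ℕ∞} {w : UnitAddTorus (Fin 3) → F} (hw : IsContDiff n w) :
    IsContDiff n (fun x : UnitAddTorus (Fin 3) => w (fun i => x (swap 1 2 i))) := by
  change ContDiff ℝ n (lift fun x : UnitAddTorus (Fin 3) => w (fun i => x (swap 1 2 i)))
  rw [lift_comp_swap]
  exact hw.comp (piLpCongrLeft 2 ℝ ℝ (swap (1 : Fin 3) 2)).contDiff

/-- `Cⁿ` vector fields stay `Cⁿ` under the conjugation `w ↦ A ∘ w ∘ P`. [folklore] -/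
theorem isContDiff_conj {n : WithTop ℕ∞} {w : UnitAddTorus (Fin 3) → EuclideanSpace ℝ (Fin 3)}
    (hw : IsContDiff n w) :
    IsContDiff n (fun x : UnitAddTorus (Fin 3) =>
      piLpCongrLeft 2 ℝ ℝ (swap 1 2) (w (fun i => x (swap 1 2 i)))) :=
  (piLpCongrLeft 2 ℝ ℝ (swap (1 : Fin 3) 2)).contDiff.comp (isContDiff_comp_swap hw)

/-- `∂ᵥ(w ∘ P)(x) = ∂_{A v} w (P x)` (by `rfl`). [folklore] -/
theorem lineDeriv_comp_swap {F : Type*} [NormedAddCommGroup F] [NormedSpace ℝ F]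
    (w : UnitAddTorus (Fin 3) → F) (x : UnitAddTorus (Fin 3)) (v : EuclideanSpace ℝ (Fin 3)) :
    Torus.lineDeriv (fun y : UnitAddTorus (Fin 3) => w (fun i => y (swap 1 2 i))) x v =
      Torus.lineDeriv w (fun i => x (swap 1 2 i)) (piLpCongrLeft 2 ℝ ℝ (swap (1 : Fin 3) 2) v) :=
  rfl

/-- `A` commutes with directional derivatives. [folklore] -/
theorem lineDeriv_a_comp (w : UnitAddTorus (Fin 3) → EuclideanSpace ℝ (Fin 3))
    (x : UnitAddTorus (Fin 3)) (v : EuclideanSpace ℝ (Fin 3)) :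
    Torus.lineDeriv (fun y => piLpCongrLeft 2 ℝ ℝ (swap 1 2) (w y)) x v =
      piLpCongrLeft 2 ℝ ℝ (swap 1 2) (Torus.lineDeriv w x v) := by
  unfold Torus.lineDeriv
  rw [← fderiv_apply_one_eq_deriv, ← fderiv_apply_one_eq_deriv]
  have h : (fun t : ℝ => piLpCongrLeft 2 ℝ ℝ (swap 1 2) (w (x + proj (t • v)))) =
      ⇑(piLpCongrLeft 2 ℝ ℝ (swap (1 : Fin 3) 2)) ∘ fun t : ℝ => w (x + proj (t • v)) :=
    rfl
  rw [h, LinearIsometryEquiv.comp_fderiv]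
  rfl

/-- `∂ᵢ (w ∘ P) = (∂_{σ i} w) ∘ P`. [folklore] -/
theorem partialDeriv_comp_swap {F : Type*} [NormedAddCommGroup F] [NormedSpace ℝ F]
    (w : UnitAddTorus (Fin 3) → F) (i : Fin 3) (x : UnitAddTorus (Fin 3)) :
    Torus.partialDeriv i (fun y : UnitAddTorus (Fin 3) => w (fun k => y (swap 1 2 k))) x =
      Torus.partialDeriv (swap 1 2 i) w (fun k => x (swap 1 2 k)) := by
  rw [Torus.partialDeriv, lineDeriv_comp_swap, a_single]
  rfl

/-- `∂ᵢ (A ∘ w ∘ P) = A ∘ (∂_{σ i} w) ∘ P`. [folklore] -/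
theorem partialDeriv_conj (w : UnitAddTorus (Fin 3) → EuclideanSpace ℝ (Fin 3)) (i : Fin 3) :
    Torus.partialDeriv i (fun y : UnitAddTorus (Fin 3) =>
        piLpCongrLeft 2 ℝ ℝ (swap 1 2) (w (fun k => y (swap 1 2 k)))) =
      fun x : UnitAddTorus (Fin 3) =>
        piLpCongrLeft 2 ℝ ℝ (swap 1 2) (Torus.partialDeriv (swap 1 2 i) w (fun k => x (swap 1 2 k))) := by
  funext x
  rw [Torus.partialDeriv, lineDeriv_a_comp, lineDeriv_comp_swap, a_single]
  rfl

/-- `div (A ∘ w ∘ P) = (div w) ∘ P`; in particular the conjugation preserves incompressibility.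
[folklore] -/
theorem divergence_conj (w : UnitAddTorus (Fin 3) → EuclideanSpace ℝ (Fin 3))
    (x : UnitAddTorus (Fin 3)) :
    divergence (fun y : UnitAddTorus (Fin 3) =>
        piLpCongrLeft 2 ℝ ℝ (swap 1 2) (w (fun k => y (swap 1 2 k)))) x =
      divergence w (fun k => x (swap 1 2 k)) := by
  simp only [Torus.divergence, LinearIsometryEquiv.piLpCongrLeft_apply, Equiv.piCongrLeft'_apply,
    Equiv.symm_swap]
  rw [← Equiv.sum_comp (swap (1 : Fin 3) 2)
    (fun j => Torus.partialDeriv j (fun z => w z j) (fun k => x (swap 1 2 k)))]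
  exact Finset.sum_congr rfl fun i _ => partialDeriv_comp_swap (fun z => w z (swap 1 2 i)) i x

/-- `Δ (A ∘ w ∘ P) = A ∘ (Δ w) ∘ P` for smooth `w`. [folklore] -/
theorem laplacian_conj {w : UnitAddTorus (Fin 3) → EuclideanSpace ℝ (Fin 3)} (hw : IsSmooth w)
    (x : UnitAddTorus (Fin 3)) :
    Torus.laplacian (fun y : UnitAddTorus (Fin 3) =>
        piLpCongrLeft 2 ℝ ℝ (swap 1 2) (w (fun k => y (swap 1 2 k)))) x =
      piLpCongrLeft 2 ℝ ℝ (swap 1 2) (Torus.laplacian w (fun k => x (swap 1 2 k))) := by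
  rw [laplacian_eq_sum_partialDeriv_partialDeriv (isContDiff_conj hw),
    laplacian_eq_sum_partialDeriv_partialDeriv hw, map_sum]
  simp only [partialDeriv_conj]
  exact Equiv.sum_comp (swap (1 : Fin 3) 2) (fun j => piLpCongrLeft 2 ℝ ℝ (swap 1 2)
    (Torus.partialDeriv j (Torus.partialDeriv j w) (fun k => x (swap 1 2 k))))

/-- The re-centred lift of a conjugated field: `liftAt (A ∘ w ∘ P) x = A ∘ liftAt w (P x) ∘ A`
(definitionally, since `P (x + proj v) = P x + proj (A v)`). [folklore] -/
theorem liftAt_conj (w : UnitAddTorus (Fin 3) → EuclideanSpace ℝ (Fin 3)) (x : UnitAddTorus (Fin 3)) :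
    liftAt (fun y : UnitAddTorus (Fin 3) =>
        piLpCongrLeft 2 ℝ ℝ (swap 1 2) (w (fun k => y (swap 1 2 k)))) x =
      ⇑(piLpCongrLeft 2 ℝ ℝ (swap (1 : Fin 3) 2)) ∘ (liftAt w (fun k => x (swap 1 2 k)) ∘
        ⇑((piLpCongrLeft 2 ℝ ℝ (swap (1 : Fin 3) 2)).toContinuousLinearEquiv)) :=
  rfl

/-- **Chain rule for the conjugation** (no differentiability needed):
`D(A ∘ w ∘ P)(x) = A ∘ Dw(P x) ∘ A`. [folklore] -/
theorem fderiv_conj (w : UnitAddTorus (Fin 3) → EuclideanSpace ℝ (Fin 3)) (x : UnitAddTorus (Fin 3)) :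
    Torus.fderiv (fun y : UnitAddTorus (Fin 3) =>
        piLpCongrLeft 2 ℝ ℝ (swap 1 2) (w (fun k => y (swap 1 2 k)))) x =
      ((piLpCongrLeft 2 ℝ ℝ (swap (1 : Fin 3) 2) :
          EuclideanSpace ℝ (Fin 3) →L[ℝ] EuclideanSpace ℝ (Fin 3)).comp
        (Torus.fderiv w (fun k => x (swap 1 2 k)))).comp
      (piLpCongrLeft 2 ℝ ℝ (swap (1 : Fin 3) 2) :
        EuclideanSpace ℝ (Fin 3) →L[ℝ] EuclideanSpace ℝ (Fin 3)) := by
  unfold Torus.fderiv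
  rw [liftAt_conj, LinearIsometryEquiv.comp_fderiv, ContinuousLinearEquiv.comp_right_fderiv, map_zero]
  rfl

/-- The inertial integrand is invariant: `⟪D(AwP)(x)[A a], A a⟫ = ⟪Dw(Px)[a], a⟫`. [folklore] -/
theorem inner_fderiv_conj (w : UnitAddTorus (Fin 3) → EuclideanSpace ℝ (Fin 3)) (x : UnitAddTorus (Fin 3))
    (a : EuclideanSpace ℝ (Fin 3)) :
    ⟪Torus.fderiv (fun y : UnitAddTorus (Fin 3) =>
          piLpCongrLeft 2 ℝ ℝ (swap 1 2) (w (fun k => y (swap 1 2 k)))) x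
        (piLpCongrLeft 2 ℝ ℝ (swap (1 : Fin 3) 2) a), piLpCongrLeft 2 ℝ ℝ (swap (1 : Fin 3) 2) a⟫_ℝ =
      ⟪Torus.fderiv w (fun k => x (swap 1 2 k)) a, a⟫_ℝ := by
  rw [fderiv_conj]
  simp only [ContinuousLinearMap.coe_comp, Function.comp_apply]
  rw [show ((piLpCongrLeft 2 ℝ ℝ (swap (1 : Fin 3) 2) :
      EuclideanSpace ℝ (Fin 3) →L[ℝ] EuclideanSpace ℝ (Fin 3)) :
        EuclideanSpace ℝ (Fin 3) → EuclideanSpace ℝ (Fin 3)) =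
      ⇑(piLpCongrLeft 2 ℝ ℝ (swap (1 : Fin 3) 2)) from rfl, a_a, LinearIsometryEquiv.inner_map_map]

/-! ## Fourier side: the spectral enstrophy is invariant -/

/-- `e_n(P z) = e_{n ∘ σ}(z)` (the tree's `HaarTorus.mFourier_comp_perm` at the self-inverse `σ`).
[folklore] -/
theorem mFourier_comp_swap (n : Fin 3 → ℤ) (z : UnitAddTorus (Fin 3)) :
    mFourier n (fun i => z (swap 1 2 i)) = mFourier (fun i => n (swap 1 2 i)) z :=
  HaarTorus.mFourier_comp_perm n (swap (1 : Fin 3) 2) z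

/-- Complexification commutes with the permutation of components. [folklore] -/
theorem complexify_a (v : EuclideanSpace ℝ (Fin 3)) :
    EuclideanSpace.complexify (piLpCongrLeft 2 ℝ ℝ (swap (1 : Fin 3) 2) v) =
      piLpCongrLeft 2 ℂ ℂ (swap 1 2) (EuclideanSpace.complexify v) := by
  ext i
  simp [EuclideanSpace.complexify_apply]

/-- **Fourier coefficients of a conjugated field**: `𝓕(A ∘ v ∘ P)(k) = Aℂ (𝓕 v (k ∘ σ))`
(unconditionally: both sides are junk-free identities of Bochner integrals). [folklore] -/
theorem mFourierCoeff_conj (v : UnitAddTorus (Fin 3) → EuclideanSpace ℝ (Fin 3)) (k : Fin 3 → ℤ) :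
    mFourierCoeff (EuclideanSpace.complexify ∘ fun x : UnitAddTorus (Fin 3) =>
        piLpCongrLeft 2 ℝ ℝ (swap 1 2) (v (fun i => x (swap 1 2 i)))) k =
      piLpCongrLeft 2 ℂ ℂ (swap 1 2)
        (mFourierCoeff (EuclideanSpace.complexify ∘ v) (fun i => k (swap 1 2 i))) := by
  rw [mFourierCoeff_eq_integral_volume, mFourierCoeff_eq_integral_volume]
  have h1 : piLpCongrLeft 2 ℂ ℂ (swap 1 2) (∫ x : UnitAddTorus (Fin 3),
        mFourier (-fun i => k (swap 1 2 i)) x • (EuclideanSpace.complexify ∘ v) x) =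
      ∫ x : UnitAddTorus (Fin 3), piLpCongrLeft 2 ℂ ℂ (swap 1 2)
        (mFourier (-fun i => k (swap 1 2 i)) x • (EuclideanSpace.complexify ∘ v) x) :=
    ((piLpCongrLeft 2 ℂ ℂ (swap (1 : Fin 3) 2)).toLinearIsometry.integral_comp_comm _).symm
  rw [h1, ← integral_comp_swap (fun y : UnitAddTorus (Fin 3) => piLpCongrLeft 2 ℂ ℂ (swap 1 2)
    (mFourier (-fun i => k (swap 1 2 i)) y • (EuclideanSpace.complexify ∘ v) y))]
  refine integral_congr_ae (ae_of_all _ fun x => ?_)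
  simp only [Function.comp_apply, complexify_a, LinearIsometryEquiv.map_smul]
  congr 1
  rw [mFourier_comp_swap]
  congr 2
  funext i
  simp

/-- `|k ∘ σ|² = |k|²`. [folklore] -/
theorem freqNormSq_comp_swap (k : Fin 3 → ℤ) :
    freqNormSq (fun i => k (swap 1 2 i)) = freqNormSq k := by
  unfold freqNormSq
  exact Equiv.sum_comp (swap (1 : Fin 3) 2) (fun j => (k j : ℝ) ^ 2)

/-- **The spectral enstrophy is invariant under the conjugation**: `‖∇(A ∘ v ∘ P)‖² = ‖∇v‖²`
(reindex the Fourier sum by `k ↦ k ∘ σ`; `Aℂ` is an isometry). [folklore] -/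
theorem eGradNormSq_conj (v : UnitAddTorus (Fin 3) → EuclideanSpace ℝ (Fin 3)) :
    eGradNormSq (fun x : UnitAddTorus (Fin 3) =>
        piLpCongrLeft 2 ℝ ℝ (swap 1 2) (v (fun i => x (swap 1 2 i)))) = eGradNormSq v := by
  have key : (∑' k : Fin 3 → ℤ, (if k = 0 then 0 else ENNReal.ofReal (freqNormSq k ^ (1 : ℝ))) *
      ‖mFourierCoeff (EuclideanSpace.complexify ∘ fun x : UnitAddTorus (Fin 3) =>
        piLpCongrLeft 2 ℝ ℝ (swap 1 2) (v (fun i => x (swap 1 2 i)))) k‖ₑ ^ 2) =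
      ∑' k : Fin 3 → ℤ, (if k = 0 then 0 else ENNReal.ofReal (freqNormSq k ^ (1 : ℝ))) *
        ‖mFourierCoeff (EuclideanSpace.complexify ∘ v) k‖ₑ ^ 2 := by
    simp_rw [mFourierCoeff_conj, LinearIsometryEquiv.enorm_map]
    let e : (Fin 3 → ℤ) ≃ (Fin 3 → ℤ) := ⟨fun k i => k (swap 1 2 i), fun k i => k (swap 1 2 i),
      fun k => by funext i; simp, fun k => by funext i; simp⟩
    rw [← Equiv.tsum_eq e]
    refine tsum_congr fun k => ?_
    simp only [e, Equiv.coe_fn_mk, Equiv.swap_apply_self, freqNormSq_comp_swap]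
    have h0 : ((fun i => k (swap 1 2 i)) = 0) ↔ k = 0 := by
      constructor
      · intro h
        funext i
        simpa using congrFun h (swap 1 2 i)
      · intro h
        subst h
        rfl
    simp only [h0]
  unfold eGradNormSq eHomSobolevSeminorm
  rw [key]

/-! ## The two forces -/

/-- A sine Stokes mode: `stokesMode k a false x = Im e_k(x) • a`. [folklore] -/
theorem stokesMode_false_apply (k : Fin 3 → ℤ) (a : EuclideanSpace ℝ (Fin 3)) (x : UnitAddTorus (Fin 3)) :
    stokesMode k a false x = (mFourier k x).im • a := by
  rw [stokesMode_apply]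
  simp

/-- A sine frame field: `frameField k j false x = Im e_k(x) • perpVec k j`. [folklore] -/
theorem frameField_false_apply (k : Fin 3 → ℤ) (j : Fin 3) (x : UnitAddTorus (Fin 3)) :
    frameField k j false x = (mFourier k x).im • perpVec k j := by
  rw [frameField, realTrigPoly_singleton_apply]
  ext i
  simp [frameVec, EuclideanSpace.realPart_apply, EuclideanSpace.complexify_apply, Complex.mul_im]

/-- `perpVec eₐ b = e_b` for `a ≠ b` (the basis vector `e_b` is already orthogonal to `eₐ`).
[folklore] -/
theorem perpVec_single_of_ne {a b : Fin 3} (hab : a ≠ b) :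
    perpVec (Pi.single a (1 : ℤ)) b = EuclideanSpace.single b (1 : ℝ) := by
  ext i
  rw [perpVec_apply]
  simp [Pi.single_apply, hab.symm, eq_comm]

/-- **The swap carries `f_GP` to the cyclic force**:
`A ∘ f_GP ∘ P = sin(2πx₁)e₀ + sin(2πx₂)e₁ + sin(2πx₀)e₂` (FSS's force, written with frame fields
exactly as in `GPOrientationBridge`; `f_GP` exactly as in `GPEulerCoercive`). [folklore] -/
theorem conj_gpForce :
    (fun x : UnitAddTorus (Fin 3) => piLpCongrLeft 2 ℝ ℝ (swap 1 2)
      (stokesMode (Pi.single (2 : Fin 3) (1 : ℤ)) (EuclideanSpace.single (0 : Fin 3) (1 : ℝ)) false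
          (fun i => x (swap 1 2 i)) +
        stokesMode (Pi.single (0 : Fin 3) (1 : ℤ)) (EuclideanSpace.single (1 : Fin 3) (1 : ℝ)) false
          (fun i => x (swap 1 2 i)) +
        stokesMode (Pi.single (1 : Fin 3) (1 : ℤ)) (EuclideanSpace.single (2 : Fin 3) (1 : ℝ)) false
          (fun i => x (swap 1 2 i)) : EuclideanSpace ℝ (Fin 3))) =
    frameField (d := Fin 3) (Pi.single 1 1) 0 false + frameField (d := Fin 3) (Pi.single 2 1) 1 false +
      frameField (d := Fin 3) (Pi.single 0 1) 2 false := by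
  have h2 : (fun i => (Pi.single (2 : Fin 3) (1 : ℤ) : Fin 3 → ℤ) (swap 1 2 i)) = Pi.single 1 1 := by
    funext i; fin_cases i <;> rfl
  have h0 : (fun i => (Pi.single (0 : Fin 3) (1 : ℤ) : Fin 3 → ℤ) (swap 1 2 i)) = Pi.single 0 1 := by
    funext i; fin_cases i <;> rfl
  have h1 : (fun i => (Pi.single (1 : Fin 3) (1 : ℤ) : Fin 3 → ℤ) (swap 1 2 i)) = Pi.single 2 1 := by
    funext i; fin_cases i <;> rfl
  funext x
  simp only [Pi.add_apply, stokesMode_false_apply, frameField_false_apply, map_add,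
    LinearIsometryEquiv.map_smul, a_single, mFourier_comp_swap, h0, h1, h2,
    perpVec_single_of_ne (show (1 : Fin 3) ≠ 0 by decide),
    perpVec_single_of_ne (show (2 : Fin 3) ≠ 1 by decide),
    perpVec_single_of_ne (show (0 : Fin 3) ≠ 2 by decide)]
  simp only [Equiv.swap_apply_def]
  simp
  abel

end OrientationBridge

end Summit.AnomalousDissipation.AnomalousDissipation.Theorems.TameRoughRigidity

end
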